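import Mathlib
import HarnessLib
import Literature.MathematicalPhysics.QuantumLattice.FermiRG.BGM2003SectorCountingTarget
import Summits.HubbardSuperconductivity.HubbardSuperconductivity.Theorems.KLProgrammeH10TwoPointLimitFrameBGM2003SectorCountingUniform
import Summits.HubbardSuperconductivity.HubbardSuperconductivity.Theorems.KLProgrammeH10TwoPointLimitFrameBGM2003SectorCountingTargetUniform

/-!
# Route `KLProgramme` — K3 engine (stmt-HubbardSuperconductivity-20437), stub (b) (ℓ)/(I2), located item «ON-CLASS-KB» (U):
# `count_target_wide` (BGM 2003 Lemma 3.1 with a target vector, WIDE-bundle variant) UNIFORM over the perturbed curves and the admissible frames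

Cell gate-hubbard-kl, seat p4 g13.  Twins of `…FrameBGM2003SectorCountingTargetUniform` (p597192) for the WIDE-bundle variant `BGM2003.count_target_wide`
of the Literature lemma: for strings in which two given non-anchored legs `i₀, j₀` have pair angle `> Φ`, the near fibre is empty, no `(2(2Φ/w′+1))²`
term is charged, and `Φ` may be taken as large as that pair allows (honest bulk loss `(1 + c₂Ψ/(K₁LΦ))²`):
* `sectorCountingTargetWide_perturbed_uniform`, `frame_bgm2003_sectorCountingTargetWide_uniform_shell`, `frameOK_bgm2003_sectorCountingTargetWide_uniform_shell`.
Everything is PROVED; no definitions, no named facts; nothing here asserts anything about the model or superconductivity.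
References: BGM 2003 §3.1 Lemma 3.1 (4.3), §7.4 [cite: BenfattoGiulianiMastropietro2003].
-/

noncomputable section

namespace Summit.HubbardSuperconductivity.HubbardSuperconductivity.Theorems.PerturbedFermiCurve

set_option linter.dupNamespace false -- summit = problem name (single-conjunct summit), D-0017

open Real Set
open Literature.MathematicalPhysics.QuantumLattice Literature.MathematicalPhysics.QuantumLattice.BandSectorCounting
open Literature.MathematicalPhysics.QuantumLattice.FermiRG Literature.MathematicalPhysics.QuantumLattice.FermiRG.BGM2003
open Summit.HubbardSuperconductivity.HubbardSuperconductivity.Theorems.DispersionFlow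
open Summit.HubbardSuperconductivity.HubbardSuperconductivity.Theorems.KLRegimeSplit

/-! ## WIDE-bundle twins (two non-anchored legs at pair angle `> Φ`: no near-fibre term) -/

/-- **`count_target_wide` for the perturbed curve, ONE tuple of constants for the family** (WIDE-bundle variant: two legs `i₀, j₀ ≠ i₁` at pair angle `> Φ`,
no near-fibre term).  Original: **`count_target` for the perturbed curve, ONE tuple of constants for the family.**  Under the hypotheses of `sectorCounting_perturbed_uniform`
there are `c₂ ≥ 0`, `c₃, K₁, K₂, c₀, c₂′ > 0` with `2 + c₂ ≤ K₁` such that for every admissible `δ`, `μ`, all `n ≤ n′`, `L ≥ 4`, anchor `ω₁`, coarse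
string `ωt`, target `R`, wedge `Ψ ≥ 0`, regime parameter `Φ` and fibre constant `B_fib` as in `count_target` (with `η₀ = 1`), the target strings of
the chart `u θ e = perturbedFermiRadius δ (μ + e) θ` (shell `e₀`) number `≤ L² · B_fib · (3·2^{n′−n})^{L−3}`.
[cite: BenfattoGiulianiMastropietro2003, §3.1 Lemma 3.1 (4.3) and §7.4] -/
theorem sectorCountingTargetWide_perturbed_uniform {a b : ℝ} (B : BandBounds a b) {κ₀ κ₁ κ₂ e₀ : ℝ} (he₀ : 0 < e₀)
    (hκ₁0 : 0 ≤ κ₁) (hκ₂0 : 0 ≤ κ₂) (hκ₁D : 2 * κ₁ ≤ B.Dtmin)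
    (hconv : B.hmin ≤ 2 * (B.hmin - 4 * (κ₁ * (π * Real.sqrt 2 + 2 * B.smax) / (B.Dtmin - κ₁)) *
        ((B.smax + κ₁ * (π * Real.sqrt 2 + 2 * B.smax) / (B.Dtmin - κ₁)) + B.smax)) -
        κ₂ * (B.smax + κ₁ * (π * Real.sqrt 2 + 2 * B.smax) / (B.Dtmin - κ₁)) ^ 2) :
    ∃ c₂ c₃ K₁ K₂ c₀ c₂' : ℝ, 0 ≤ c₂ ∧ 0 < c₃ ∧ 2 + c₂ ≤ K₁ ∧ 0 < K₂ ∧ 0 < c₀ ∧ 0 < c₂' ∧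
      ∀ (δ : (Fin 2 → ℝ) → ℝ), ContDiff ℝ ((⊤ : ℕ∞) : WithTop ℕ∞) δ → (∀ k, δ (-k) = δ k) →
      (∀ k : Fin 2 → ℝ, |δ k| ≤ κ₀) → (∀ k : Fin 2 → ℝ, ‖fderiv ℝ δ k‖ ≤ κ₁) → (∀ k : Fin 2 → ℝ, ‖fderiv ℝ (fderiv ℝ δ) k‖ ≤ κ₂) →
      ∀ μ : ℝ, a + κ₀ + 2 * e₀ ≤ μ → μ + κ₀ + 2 * e₀ ≤ b →
      ∀ (n n' : ℕ), n ≤ n' → ∀ (L : ℕ), 4 ≤ L → ∀ (i₁ : Fin L) (ω₁ : ℕ), ω₁ < sectorCount n' → ∀ (ωt : Fin L → ℕ), (∀ i, ωt i < sectorCount n) →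
      ∀ (R : Fin 2 → ℝ) (Φ Ψ LΨ Bfib : ℝ), 0 ≤ Ψ → LΨ = L + c₂ * Ψ / (K₁ * Φ) → (2 : ℝ) ^ (-(n' : ℤ)) ≤ Φ → c₃ * (2 : ℝ) ^ (-(n' : ℤ)) ≤ Φ →
        K₂ * LΨ * (c₃ * (2 : ℝ) ^ (-(n' : ℤ))) ≤ c₂' * Φ →
        max ((2 * ((2 * c₀ * K₂ * c₃ / π + 1) * LΨ)) ^ 2) (4 * c₃ ^ 2 * K₂ ^ 2 / 1 ^ 2 * LΨ ^ 2) ≤ Bfib →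
        ∀ (i₀ j₀ : Fin L), i₀ ≠ i₁ → j₀ ≠ i₁ →
        (Nat.card {ω : Fin L → Fin (sectorCount n') |
            (ω i₁ : ℕ) = ω₁ ∧ (∀ i' : Fin L, i' ≠ i₁ →
              sSector (fun ϑ e => perturbedFermiRadius δ (μ + e) ϑ) e₀ n' (ω i' : ℕ) ⊆ sSector (fun ϑ e => perturbedFermiRadius δ (μ + e) ϑ) e₀ n (ωt i')) ∧
            (∀ m : Fin L, m ≠ i₁ → pairAngle (sectorCenter n' (ω i₁)) (sectorCenter n' (ω m)) ≤ Ψ) ∧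
            Φ < pairAngle (sectorCenter n' (ω i₀)) (sectorCenter n' (ω j₀)) ∧
            ∃ k : Fin L → (Fin 2 → ℝ), (∀ i' : Fin L, k i' ∈ sSector (fun ϑ e => perturbedFermiRadius δ (μ + e) ϑ) e₀ n' (ω i' : ℕ)) ∧
              ∑ i', k i' = R} : ℝ) ≤
          L ^ 2 * (Bfib * (3 * (2 : ℝ) ^ (n' - n)) ^ (L - 3)) := by
  have hDt := B.Dtmin_pos; have hum := B.umin_pos; have hsm := B.smax_pos; have hhm := B.hmin_pos; have hπ := Real.pi_pos
  have hκ₁lt : κ₁ < B.Dtmin := by linarith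
  have hden : 0 < B.Dtmin - κ₁ := sub_pos.2 hκ₁lt
  have h00 : |(0 : ℝ)| ≤ e₀ := by rw [abs_zero]; exact he₀.le
  -- (u3): the δ-uniform sector box
  obtain ⟨c₃, hc₃, hbox⟩ := sectorBox_perturbed_uniform B (κ₀ := κ₀) he₀ hκ₁0 hκ₁lt hκ₂0
  -- the composition, for every `δ, μ` (the constants are read off by unification below)
  have hmain := fun (δ : (Fin 2 → ℝ) → ℝ) (hδs : ContDiff ℝ ((⊤ : ℕ∞) : WithTop ℕ∞) δ) (heven : ∀ k, δ (-k) = δ k)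
      (hδ : ∀ k : Fin 2 → ℝ, |δ k| ≤ κ₀) (hκ : ∀ k : Fin 2 → ℝ, ‖fderiv ℝ δ k‖ ≤ κ₁)
      (hκ₂ : ∀ k : Fin 2 → ℝ, ‖fderiv ℝ (fderiv ℝ δ) k‖ ≤ κ₂)
      (μ : ℝ) (hlo : a + κ₀ + 2 * e₀ ≤ μ) (hhi : μ + κ₀ + 2 * e₀ ≤ b) (n n' : ℕ) (hn : n ≤ n')
      (L : ℕ) (hL : 4 ≤ L) (i₁ : Fin L) (ω₁ : ℕ) (hω₁ : ω₁ < sectorCount n') (ωt : Fin L → ℕ) (hωt : ∀ i, ωt i < sectorCount n)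
      (R : Fin 2 → ℝ) (Φ Ψ LΨ Bfib : ℝ) (hΨ : 0 ≤ Ψ) =>
    have hδ2 : ContDiff ℝ 2 δ := hδs.of_le (WithTop.coe_le_coe.mpr le_top)
    have hδ' : ∀ k : Fin 2 → ℝ, (∀ i, |k i| ≤ π) → |δ k| ≤ κ₀ := fun k _ => hδ k
    have hκ' : ∀ k : Fin 2 → ℝ, (∀ i, |k i| ≤ π) → ‖fderiv ℝ δ k‖ ≤ κ₁ := fun k _ => hκ k
    have hκ₂' : ∀ k : Fin 2 → ℝ, (∀ i, |k i| ≤ π) → ‖fderiv ℝ (fderiv ℝ δ) k‖ ≤ κ₂ := fun k _ => hκ₂ k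
    have hlo0 : a ≤ μ - κ₀ := by linarith
    have hhi0 : μ + κ₀ ≤ b := by linarith
    have hlo1 : a ≤ μ - κ₀ - e₀ := by linarith
    have hhi1 : μ + κ₀ + e₀ ≤ b := by linarith
    -- BGM 2003 §1.2 for the chart; (u1) radius data; (u2) Gauss map; (u3) box; (u4) parallelogram lemma
    have hD := dispersionHyp_perturbed B hδs heven hδ' hκ' hκ₂' hκ₁D hconv he₀ hlo hhi
    have hrad := chart_radius_ge B hδ2 hδ' hlo1 hhi1
    have hM := chart_radius_bounds B hδ2 hδ' hlo1 hhi1 hκ' hκ₁lt hκ₂'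
    fun (hLΨ : LΨ = L + _ * Ψ / (_ * Φ)) (hΦt : (2 : ℝ) ^ (-(n' : ℤ)) ≤ Φ) (hΦδ : c₃ * (2 : ℝ) ^ (-(n' : ℤ)) ≤ Φ)
        (hΦη : _ * LΨ * (c₃ * (2 : ℝ) ^ (-(n' : ℤ))) ≤ _ * Φ)
        (hBfib : max ((2 * ((2 * _ * _ * c₃ / π + 1) * LΨ)) ^ 2) (4 * c₃ ^ 2 * _ ^ 2 / 1 ^ 2 * LΨ ^ 2) ≤ Bfib)
        (i₀ j₀ : Fin L) (hi₀ : i₀ ≠ i₁) (hj₀ : j₀ ≠ i₁) =>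
    count_target_wide hD (normalAngle_perturbed_lipschitz B hδ2 hδ' hlo0 hhi0 hκ' hκ₁lt hκ₂') (fun θ => normalAngle_perturbed_add_pi heven θ)
      (by positivity) hc₃ (hbox δ hδ2 hδ hκ hκ₂ μ hlo1 hhi1) (by positivity) rfl (by positivity) (by positivity) one_pos
      (lemma75_parallelogram_of_bounds hD hum hrad (by positivity) (chart_curvature_ge B hδ2 hδ' hlo1 hhi1 hκ' hκ₁lt hκ₂' hconv)
        (by positivity) hM (by positivity))
      hn hL i₁ hω₁ hωt R hΨ le_rfl hLΨ hΦt hΦδ hΦη hBfib hi₀ hj₀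
  exact ⟨_, c₃, _, _, _, _, by positivity, hc₃, le_rfl, by positivity, by positivity, by positivity,
    fun δ hδs heven hδ hκ hκ₂ μ hlo hhi n n' hn L hL i₁ ω₁ hω₁ ωt hωt R Φ Ψ LΨ Bfib hΨ hLΨ hΦt hΦδ hΦη hBfib i₀ j₀ hi₀ hj₀ =>
      hmain δ hδs heven hδ hκ hκ₂ μ hlo hhi n n' hn L hL i₁ ω₁ hω₁ ωt hωt R Φ Ψ LΨ Bfib hΨ hLΨ hΦt hΦδ hΦη hBfib i₀ j₀ hi₀ hj₀⟩

/-- **`count_target_wide` ON THE CURVES OF ALL FRAMES of small `C²` size, prescribed shell** (WIDE-bundle variant).  Original: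
**`count_target` ON THE CURVES OF ALL FRAMES of small `C²` size, prescribed shell, ONE tuple of constants** (target twin of
`frame_bgm2003_sectorCounting_uniform_shell`). [cite: BenfattoGiulianiMastropietro2003, §3.1 Lemma 3.1 (4.3) and §7.4] -/
theorem frame_bgm2003_sectorCountingTargetWide_uniform_shell :
    ∀ μ₁ μ₂ e₀ : ℝ, 0 < e₀ → -4 < μ₁ - 4 * e₀ → μ₁ ≤ μ₂ → μ₂ + 4 * e₀ < 0 → ∃ κ : ℝ, 0 < κ ∧
      ∃ c₂ c₃ K₁ K₂ c₀ c₂' : ℝ, 0 ≤ c₂ ∧ 0 < c₃ ∧ 2 + c₂ ≤ K₁ ∧ 0 < K₂ ∧ 0 < c₀ ∧ 0 < c₂' ∧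
      ∀ (K : TrigPolyC4v) (A : ℝ), (∀ p : Momentum, ∀ j ≤ 2, ‖iteratedFDeriv ℝ j (frameShift K) p‖ ≤ A) → 4 * A ≤ κ →
      ∀ μ ∈ Set.Icc μ₁ μ₂, ∀ (n n' : ℕ), n ≤ n' → ∀ (L : ℕ), 4 ≤ L → ∀ (i₁ : Fin L) (ω₁ : ℕ), ω₁ < sectorCount n' →
      ∀ (ωt : Fin L → ℕ), (∀ i, ωt i < sectorCount n) →
      ∀ (R : Fin 2 → ℝ) (Φ Ψ LΨ Bfib : ℝ), 0 ≤ Ψ → LΨ = L + c₂ * Ψ / (K₁ * Φ) → (2 : ℝ) ^ (-(n' : ℤ)) ≤ Φ → c₃ * (2 : ℝ) ^ (-(n' : ℤ)) ≤ Φ →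
        K₂ * LΨ * (c₃ * (2 : ℝ) ^ (-(n' : ℤ))) ≤ c₂' * Φ →
        max ((2 * ((2 * c₀ * K₂ * c₃ / π + 1) * LΨ)) ^ 2) (4 * c₃ ^ 2 * K₂ ^ 2 / 1 ^ 2 * LΨ ^ 2) ≤ Bfib →
        ∀ (i₀ j₀ : Fin L), i₀ ≠ i₁ → j₀ ≠ i₁ →
        (Nat.card {ω : Fin L → Fin (sectorCount n') |
            (ω i₁ : ℕ) = ω₁ ∧ (∀ i' : Fin L, i' ≠ i₁ →
              sSector (fun ϑ e => perturbedFermiRadius (fun q : Fin 2 → ℝ => frameShift K (WithLp.toLp 2 q)) (μ + e) ϑ) e₀ n' (ω i' : ℕ) ⊆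
                sSector (fun ϑ e => perturbedFermiRadius (fun q : Fin 2 → ℝ => frameShift K (WithLp.toLp 2 q)) (μ + e) ϑ) e₀ n (ωt i')) ∧
            (∀ m : Fin L, m ≠ i₁ → pairAngle (sectorCenter n' (ω i₁)) (sectorCenter n' (ω m)) ≤ Ψ) ∧
            Φ < pairAngle (sectorCenter n' (ω i₀)) (sectorCenter n' (ω j₀)) ∧
            ∃ k : Fin L → (Fin 2 → ℝ), (∀ i' : Fin L, k i' ∈
                sSector (fun ϑ e => perturbedFermiRadius (fun q : Fin 2 → ℝ => frameShift K (WithLp.toLp 2 q)) (μ + e) ϑ) e₀ n' (ω i' : ℕ)) ∧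
              ∑ i', k i' = R} : ℝ) ≤
          L ^ 2 * (Bfib * (3 * (2 : ℝ) ^ (n' - n)) ^ (L - 3)) := by
  intro μ₁ μ₂ e₀ he₀ hμ₁ h12 hμ₂
  have hab : μ₁ - 4 * e₀ ≤ μ₂ + 4 * e₀ := by linarith
  obtain ⟨B, -⟩ : ∃ B : BandBounds (μ₁ - 4 * e₀) (μ₂ + 4 * e₀), B = bandBounds hμ₁ hab hμ₂ := ⟨_, rfl⟩
  have hDt := B.Dtmin_pos; have hs := B.smax_pos; have hh := B.hmin_pos; have hπ := Real.pi_pos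
  -- the uniform majorants of `K_V`, `S_E` (as in `dispersionHyp_frame`)
  obtain ⟨c₁, hc₁⟩ : ∃ c₁ : ℝ, c₁ = π * Real.sqrt 2 + 2 * B.smax := ⟨_, rfl⟩
  have hc₁0 : 0 < c₁ := by rw [hc₁]; positivity
  obtain ⟨cV, hcV⟩ : ∃ cV : ℝ, cV = 2 * c₁ / B.Dtmin := ⟨_, rfl⟩
  have hcV0 : 0 < cV := by rw [hcV]; positivity
  obtain ⟨SEm, hSEm⟩ : ∃ SEm : ℝ, SEm = B.smax + c₁ := ⟨_, rfl⟩
  have hSEm0 : 0 < SEm := by rw [hSEm]; positivity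
  obtain ⟨κ, hκdef⟩ : ∃ κ : ℝ, κ = min B.Dtmin (min (8 * e₀) (B.hmin / (4 * cV * (SEm + B.smax) + SEm ^ 2))) := ⟨_, rfl⟩
  have hκ0 : 0 < κ := by rw [hκdef]; exact lt_min hDt (lt_min (by positivity) (by positivity))
  have hκD : κ ≤ B.Dtmin := by rw [hκdef]; exact min_le_left _ _
  have hκm : κ ≤ 8 * e₀ := by rw [hκdef]; exact (min_le_right _ _).trans (min_le_left _ _)
  have hκh : κ ≤ B.hmin / (4 * cV * (SEm + B.smax) + SEm ^ 2) := by rw [hκdef]; exact (min_le_right _ _).trans (min_le_right _ _)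
  -- the extreme sizes `A₀ = κ/4`: `κ₀ = A₀`, `κ₁ = 2A₀`, `κ₂ = 4A₀`
  obtain ⟨A, hAdef⟩ : ∃ A : ℝ, A = κ / 4 := ⟨_, rfl⟩
  have hA0 : 0 ≤ A := by rw [hAdef]; positivity
  have hAκ : 4 * A ≤ κ := by rw [hAdef]; linarith
  have h2κ₁ : 2 * (2 * A) ≤ B.Dtmin := by linarith
  -- the convexity margin at the extreme sizes (verbatim the computation of `dispersionHyp_frame`)
  have hden0 : 0 < B.Dtmin - 2 * A := by linarith
  have hKV : 2 * A * (π * Real.sqrt 2 + 2 * B.smax) / (B.Dtmin - 2 * A) ≤ cV * (2 * A) := by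
    rw [← hc₁, hcV, div_le_iff₀ hden0]
    have e : 2 * c₁ / B.Dtmin * (2 * A) * (B.Dtmin - 2 * A) = 2 * A * c₁ * (2 * (B.Dtmin - 2 * A) / B.Dtmin) := by
      field_simp
    rw [e]
    have h1 : 1 ≤ 2 * (B.Dtmin - 2 * A) / B.Dtmin := by rw [le_div_iff₀ hDt]; linarith
    have h0 : 0 ≤ 2 * A * c₁ := by positivity
    nlinarith
  have hKV0 : 0 ≤ 2 * A * (π * Real.sqrt 2 + 2 * B.smax) / (B.Dtmin - 2 * A) := by positivity
  have hSE : B.smax + 2 * A * (π * Real.sqrt 2 + 2 * B.smax) / (B.Dtmin - 2 * A) ≤ SEm := by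
    have hKV' : 2 * A * (π * Real.sqrt 2 + 2 * B.smax) / (B.Dtmin - 2 * A) ≤ c₁ := by
      refine hKV.trans ?_
      rw [hcV]
      have : 2 * c₁ / B.Dtmin * (2 * A) = c₁ * (4 * A / B.Dtmin) := by
        field_simp
        ring
      rw [this]
      have h1 : 4 * A / B.Dtmin ≤ 1 := by rw [div_le_one hDt]; linarith
      nlinarith
    rw [hSEm]; linarith
  have hSE0 : 0 ≤ B.smax + 2 * A * (π * Real.sqrt 2 + 2 * B.smax) / (B.Dtmin - 2 * A) := by positivity
  have hconv : B.hmin ≤ 2 * (B.hmin - 4 * (2 * A * (π * Real.sqrt 2 + 2 * B.smax) / (B.Dtmin - 2 * A)) *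
        ((B.smax + 2 * A * (π * Real.sqrt 2 + 2 * B.smax) / (B.Dtmin - 2 * A)) + B.smax)) -
        4 * A * (B.smax + 2 * A * (π * Real.sqrt 2 + 2 * B.smax) / (B.Dtmin - 2 * A)) ^ 2 := by
    have h1 : 4 * (2 * A * (π * Real.sqrt 2 + 2 * B.smax) / (B.Dtmin - 2 * A)) *
        ((B.smax + 2 * A * (π * Real.sqrt 2 + 2 * B.smax) / (B.Dtmin - 2 * A)) + B.smax) ≤ 4 * (cV * (2 * A)) * (SEm + B.smax) :=
      mul_le_mul (mul_le_mul_of_nonneg_left hKV (by norm_num)) (by linarith) (by positivity) (by positivity)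
    have h2 : 4 * A * (B.smax + 2 * A * (π * Real.sqrt 2 + 2 * B.smax) / (B.Dtmin - 2 * A)) ^ 2 ≤ 4 * A * SEm ^ 2 :=
      mul_le_mul_of_nonneg_left (pow_le_pow_left₀ hSE0 hSE 2) (by positivity)
    have h3 : κ * (4 * cV * (SEm + B.smax) + SEm ^ 2) ≤ B.hmin := by
      rwa [le_div_iff₀ (by positivity)] at hκh
    have h5 : 0 ≤ 4 * cV * (SEm + B.smax) + SEm ^ 2 := by positivity
    nlinarith [mul_le_mul_of_nonneg_right hAκ h5]
  -- the uniform count at the extreme sizes, prescribed shell `e₀`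
  obtain ⟨c₂, c₃, K₁, K₂, c₀, c₂', h1, h2, h3, h4, h5, h6, hcount⟩ := sectorCountingTargetWide_perturbed_uniform B (κ₀ := A) (e₀ := e₀) he₀
    (by positivity : 0 ≤ 2 * A) (by positivity : 0 ≤ 4 * A) h2κ₁ hconv
  refine ⟨κ, hκ0, c₂, c₃, K₁, K₂, c₀, c₂', h1, h2, h3, h4, h5, h6, ?_⟩
  intro K A' hA' hA'κ μ hμ
  have hA'A : A' ≤ A := by rw [hAdef]; linarith
  have hδ : ∀ k : Fin 2 → ℝ, |frameShift K (WithLp.toLp 2 k)| ≤ A := fun k => (abs_frameShift_toLp_le hA' k).trans hA'A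
  have hκ₁ : ∀ k : Fin 2 → ℝ, ‖fderiv ℝ (fun k : Fin 2 → ℝ => frameShift K (WithLp.toLp 2 k)) k‖ ≤ 2 * A :=
    fun k => (norm_fderiv_frameShift_toLp_le hA' k).trans (by linarith)
  have hκ₂ : ∀ k : Fin 2 → ℝ, ‖fderiv ℝ (fderiv ℝ (fun k : Fin 2 → ℝ => frameShift K (WithLp.toLp 2 k))) k‖ ≤ 4 * A :=
    fun k => (norm_fderiv_fderiv_frameShift_toLp_le hA' k).trans (by linarith)
  have hA2 : A ≤ 2 * e₀ := by rw [hAdef]; linarith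
  have hlo : μ₁ - 4 * e₀ + A + 2 * e₀ ≤ μ := by linarith [hμ.1]
  have hhi : μ + A + 2 * e₀ ≤ μ₂ + 4 * e₀ := by linarith [hμ.2]
  exact hcount _ (contDiff_frameShift_toLp K) (frameShift_toLp_neg K) hδ hκ₁ hκ₂ μ hlo hhi


/-- **`count_target_wide` ON EVERY ADMISSIBLE FRAME IN THE KL REGIME, prescribed shell** (WIDE-bundle variant).  Original:
**`count_target` ON EVERY ADMISSIBLE FRAME IN THE KL REGIME, prescribed shell, ONE tuple of constants** (target twin of
`frameOK_bgm2003_sectorCounting_uniform_shell`; `cb` = the sector-box constant, the inner `c₃, U₀` = the regime thresholds of `frame_thresholds`).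
[cite: BenfattoGiulianiMastropietro2003, §3.1 Lemma 3.1 (4.3) and §7.4] -/
theorem frameOK_bgm2003_sectorCountingTargetWide_uniform_shell :
    ∀ μ₁ μ₂ e₀ : ℝ, 0 < e₀ → -4 < μ₁ - 4 * e₀ → μ₁ ≤ μ₂ → μ₂ + 4 * e₀ < 0 →
      ∃ c₂ cb K₁ K₂ c₀ c₂' : ℝ, 0 ≤ c₂ ∧ 0 < cb ∧ 2 + c₂ ≤ K₁ ∧ 0 < K₂ ∧ 0 < c₀ ∧ 0 < c₂' ∧ ∀ Rc : RenConsts, (∀ j, 0 ≤ Rc.Gfr j) →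
      ∃ c₃ : ℝ, 0 < c₃ ∧ ∃ U₀ : ℝ, 0 < U₀ ∧
      ∀ c : ℝ, 0 < c → c ≤ c₃ → ∀ U : ℝ, 0 < U → U ≤ U₀ → ∀ β : ℝ, klBetaMin ≤ β → β ≤ Real.exp (c / U ^ 2) →
      ∀ μ ∈ Set.Icc μ₁ μ₂, ∀ (ν : ℝ) (K : TrigPolyC4v), FrameOK Rc U (nScales β) ν K →
      ∀ (n n' : ℕ), n ≤ n' → ∀ (L : ℕ), 4 ≤ L → ∀ (i₁ : Fin L) (ω₁ : ℕ), ω₁ < sectorCount n' →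
      ∀ (ωt : Fin L → ℕ), (∀ i, ωt i < sectorCount n) →
      ∀ (R : Fin 2 → ℝ) (Φ Ψ LΨ Bfib : ℝ), 0 ≤ Ψ → LΨ = L + c₂ * Ψ / (K₁ * Φ) → (2 : ℝ) ^ (-(n' : ℤ)) ≤ Φ → cb * (2 : ℝ) ^ (-(n' : ℤ)) ≤ Φ →
        K₂ * LΨ * (cb * (2 : ℝ) ^ (-(n' : ℤ))) ≤ c₂' * Φ →
        max ((2 * ((2 * c₀ * K₂ * cb / π + 1) * LΨ)) ^ 2) (4 * cb ^ 2 * K₂ ^ 2 / 1 ^ 2 * LΨ ^ 2) ≤ Bfib →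
        ∀ (i₀ j₀ : Fin L), i₀ ≠ i₁ → j₀ ≠ i₁ →
        (Nat.card {ω : Fin L → Fin (sectorCount n') |
            (ω i₁ : ℕ) = ω₁ ∧ (∀ i' : Fin L, i' ≠ i₁ →
              sSector (fun ϑ e => perturbedFermiRadius (fun q : Fin 2 → ℝ => frameShift K (WithLp.toLp 2 q)) (μ + e) ϑ) e₀ n' (ω i' : ℕ) ⊆
                sSector (fun ϑ e => perturbedFermiRadius (fun q : Fin 2 → ℝ => frameShift K (WithLp.toLp 2 q)) (μ + e) ϑ) e₀ n (ωt i')) ∧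
            (∀ m : Fin L, m ≠ i₁ → pairAngle (sectorCenter n' (ω i₁)) (sectorCenter n' (ω m)) ≤ Ψ) ∧
            Φ < pairAngle (sectorCenter n' (ω i₀)) (sectorCenter n' (ω j₀)) ∧
            ∃ k : Fin L → (Fin 2 → ℝ), (∀ i' : Fin L, k i' ∈
                sSector (fun ϑ e => perturbedFermiRadius (fun q : Fin 2 → ℝ => frameShift K (WithLp.toLp 2 q)) (μ + e) ϑ) e₀ n' (ω i' : ℕ)) ∧
              ∑ i', k i' = R} : ℝ) ≤
          L ^ 2 * (Bfib * (3 * (2 : ℝ) ^ (n' - n)) ^ (L - 3)) := by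
  intro μ₁ μ₂ e₀ he₀ hμ₁ h12 hμ₂
  obtain ⟨κ, hκ, c₂, k₃, K₁, K₂, c₀, c₂', h1, h2, h3, h4, h5, h6, h⟩ :=
    frame_bgm2003_sectorCountingTargetWide_uniform_shell μ₁ μ₂ e₀ he₀ hμ₁ h12 hμ₂
  refine ⟨c₂, k₃, K₁, K₂, c₀, c₂', h1, h2, h3, h4, h5, h6, fun Rc hR => ?_⟩
  obtain ⟨c₃, hc₃, U₀, hU₀, hthr⟩ := frame_thresholds hR hκ
  refine ⟨c₃, hc₃, U₀, hU₀, ?_⟩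
  intro c hc hcle U hU hUle β hβmin hβc μ hμ ν K hK
  exact h K _ (fun p j hj => norm_iteratedFDeriv_frameShift_le_of_frameOK_regime hR hc.le hβmin hβc hK p hj)
    (hthr c U hc.le hcle hU hUle) μ hμ


end Summit.HubbardSuperconductivity.HubbardSuperconductivity.Theorems.PerturbedFermiCurve

end
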